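import Summits.HubbardSuperconductivity.HubbardSuperconductivity.Theorems.SgCorridor.Negative.AnchorFreezeAveraging

/-!
# `SgCorridor` — negative side, part 2/3: the electric operator, the pair bound, the model

Continuation of `AnchorFreezeAveraging`. Contents:

* the verbatim electric matrix of the route items IS `Σ_b E_b` (`one_kron_elOp_mulVec`), so the
  electric energy is the total link excitation `Σ_b ‖E_b v‖²`;
* the ABSTRACT PAIR-DECORRELATION BOUND (`pair_sum_bound`): for bond operators `M_b` of norm `≤ C`
  with `[A_b, M_{b'}] = 0` (`b ≠ b'`) and `A_b M_b A_b = 0`,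
  `‖Σ_b M_b v‖² ≤ C²|B| ‖v‖² + 2C²|B| ‖v‖ Σ_b ‖E_b v‖` — cross terms are paid by excited links;
* NAMED COPIES of the objects inlined in `Theses/ColourTheSpin.lean` (`rQ, mQ, ivQ, hopQ, magW,
  dblQ, HQ, pairD, Pb, PQ, pN, BlockOrder`) with `sgAnchorOrder_iff : SgAnchorOrder ↔ … BlockOrder …`
  by `Iff.rfl` (`pN` must stay an `abbrev` and the Model section keeps the route file's instance
  defaults, or the definitional bridge breaks);
* the representation facts `|ρ(u)_{στ}| ≤ 1`, `tr ρ(u) ∈ ℝ`, and the Schur/Elitzur average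
  `Σ_{u ∈ Q8} ρ(u)_{στ} = 0` (`sum_rQ`);
* extension by zero of block vectors (`ext0`) and a Rayleigh-form ground state of a Hermitian matrix
  (`exists_ground`, from the tree's `groundSpace_ne_bot_holds` / `posSemidef_sub_groundEnergy`).

Refuter crux-attack 2026-08-17.
-/

-- `HubbardSuperconductivity.HubbardSuperconductivity` is the mandated Summit/Sub namespace (D-0017).
set_option linter.dupNamespace false

noncomputable section

namespace Summit.HubbardSuperconductivity.HubbardSuperconductivity.Theorems

namespace SgAnchorFreeze

open Literature.MathematicalPhysics.QuantumLattice Literature.Hubbard Matrix Finset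
open scoped Kronecker ComplexOrder

/-! ### The electric operator as a sum of complementary link projections -/

section Electric

variable {α β : Type*} [Fintype α] [DecidableEq α] [Fintype β] [DecidableEq β]

/-- Reindex the sum over configurations differing from `k` only at link `b` by the value there. [folklore] -/
theorem sum_ite_update (k : β → Q) (b : β) (f : (β → Q) → ℂ) :
    ∑ k', (if k' = Function.update k b (k' b) then f k' else 0) =
      ∑ u : Q, f (Function.update k b u) := by
  rw [← Finset.sum_filter]
  have hset : Finset.univ.filter (fun k' : β → Q => k' = Function.update k b (k' b)) =
      Finset.univ.image (fun u => Function.update k b u) := by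
    ext k'
    simp only [Finset.mem_filter, Finset.mem_univ, true_and, Finset.mem_image]
    constructor
    · intro h; exact ⟨k' b, h.symm⟩
    · rintro ⟨u, rfl⟩; simp
  rw [hset, Finset.sum_image]
  intro u _ u' _ h
  have := congrFun h b
  simpa using this

variable (β) in
/-- The electric operator `Σ_b E_b`, `E_b = 1 - (average over link b)` (verbatim matrix form). [folklore] -/
def elOp : Matrix (β → Q) (β → Q) ℂ :=
  ∑ b : β, Matrix.of fun k k' : β → Q =>
    if k' = Function.update k b (k' b) then (if k b = k' b then (1 : ℂ) else 0) - 1 / 8 else 0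

/-- `(1 ⊗ Σ_b E_b) v = Σ_b (v - A_b v)`: the inlined electric matrix IS the sum of the complementary link projections. [folklore] -/
theorem one_kron_elOp_mulVec (v : α × (β → Q) → ℂ) :
    ((1 : Matrix α α ℂ) ⊗ₖ elOp β) *ᵥ v = ∑ b, (v - lavg b v) := by
  funext ⟨s, k⟩
  rw [one_kron_mulVec_apply, Finset.sum_apply]
  simp only [elOp, mulVec, dotProduct, Matrix.sum_apply, Matrix.of_apply, Finset.sum_mul]
  rw [Finset.sum_comm]
  refine Finset.sum_congr rfl fun b _ => ?_
  simp only [ite_mul, zero_mul]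
  rw [sum_ite_update k b (fun k' => ((if k b = k' b then (1 : ℂ) else 0) - 1 / 8) * v (s, k'))]
  simp only [Function.update_self, sub_mul, Finset.sum_sub_distrib, ite_mul, one_mul, zero_mul,
    Finset.sum_ite_eq, Finset.mem_univ, if_true, Function.update_eq_self, Pi.sub_apply, lavg_apply,
    ← Finset.mul_sum, one_div]

/-- The electric energy is the total link excitation: `Re ⟨v, (1 ⊗ Σ_b E_b) v⟩ = Σ_b ‖v - A_b v‖²`. [folklore] -/
theorem re_star_dotProduct_elOp (v : α × (β → Q) → ℂ) :
    (star v ⬝ᵥ (((1 : Matrix α α ℂ) ⊗ₖ elOp β) *ᵥ v)).re = ∑ b, eucNorm (v - lavg b v) ^ 2 := by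
  rw [one_kron_elOp_mulVec, dotProduct_sum, Complex.re_sum]
  exact Finset.sum_congr rfl fun b _ => re_star_dotProduct_sub_lavg b v

end Electric


/-! ### Abstract pair-decorrelation bound -/

section PairBound

variable {α β : Type*} [Fintype α] [Fintype β] [DecidableEq β]

/-- Cross terms between two bond operators are controlled by the electric excitation of one bond. [folklore] -/
theorem pair_cross_bound {C : ℝ} (hC : 0 ≤ C) (b : β)
    (M M' : Matrix (α × (β → Q)) (α × (β → Q)) ℂ)
    (hM : ∀ w, eucNorm (M *ᵥ w) ≤ C * eucNorm w) (hM' : ∀ w, eucNorm (M' *ᵥ w) ≤ C * eucNorm w)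
    (hcomm : ∀ w, lavg b (M' *ᵥ w) = M' *ᵥ lavg b w) (hkill : ∀ w, lavg b (M *ᵥ lavg b w) = 0)
    (v : α × (β → Q) → ℂ) :
    ‖star (M *ᵥ v) ⬝ᵥ (M' *ᵥ v)‖ ≤ 2 * C ^ 2 * eucNorm v * eucNorm (v - lavg b v) := by
  set A := lavg b v with hA
  have hsplit : M *ᵥ v = M *ᵥ (v - A) + M *ᵥ A := by
    rw [← mulVec_add, sub_add_cancel]
  have hx : M *ᵥ A = M *ᵥ A - lavg b (M *ᵥ A) := by
    rw [hA, hkill, sub_zero]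
  rw [hsplit, star_add, add_dotProduct]
  have h1 : ‖star (M *ᵥ (v - A)) ⬝ᵥ (M' *ᵥ v)‖ ≤ C * eucNorm (v - A) * (C * eucNorm v) :=
    (norm_star_dotProduct_le _ _).trans (mul_le_mul (hM _) (hM' _) (eucNorm_nonneg _)
      (mul_nonneg hC (eucNorm_nonneg _)))
  have h2 : ‖star (M *ᵥ A) ⬝ᵥ (M' *ᵥ v)‖ ≤ C * eucNorm v * (C * eucNorm (v - A)) := by
    rw [hx, star_dotProduct_sub_lavg, hcomm, ← mulVec_sub]
    refine (norm_star_dotProduct_le _ _).trans (mul_le_mul ((hM _).trans ?_) (hM' _)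
      (eucNorm_nonneg _) (mul_nonneg hC (eucNorm_nonneg _)))
    exact mul_le_mul_of_nonneg_left (eucNorm_lavg_le b v) hC
  calc ‖star (M *ᵥ (v - A)) ⬝ᵥ (M' *ᵥ v) + star (M *ᵥ A) ⬝ᵥ (M' *ᵥ v)‖
      ≤ ‖star (M *ᵥ (v - A)) ⬝ᵥ (M' *ᵥ v)‖ + ‖star (M *ᵥ A) ⬝ᵥ (M' *ᵥ v)‖ := norm_add_le _ _
    _ ≤ C * eucNorm (v - A) * (C * eucNorm v) + C * eucNorm v * (C * eucNorm (v - A)) :=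
        add_le_add h1 h2
    _ = 2 * C ^ 2 * eucNorm v * eucNorm (v - A) := by ring

/-- The pair-field norm: diagonal terms `+` cross terms. [folklore] -/
theorem pair_sum_bound {C : ℝ} (hC : 0 ≤ C) (M : β → Matrix (α × (β → Q)) (α × (β → Q)) ℂ)
    (hM : ∀ b w, eucNorm (M b *ᵥ w) ≤ C * eucNorm w)
    (hcomm : ∀ b b', b ≠ b' → ∀ w, lavg b (M b' *ᵥ w) = M b' *ᵥ lavg b w)
    (hkill : ∀ b w, lavg b (M b *ᵥ lavg b w) = 0) (v : α × (β → Q) → ℂ) :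
    eucNorm ((∑ b, M b) *ᵥ v) ^ 2 ≤
      C ^ 2 * Fintype.card β * eucNorm v ^ 2 +
        2 * C ^ 2 * Fintype.card β * eucNorm v * ∑ b, eucNorm (v - lavg b v) := by
  rw [eucNorm_sq, sum_mulVec, star_sum, sum_dotProduct, Complex.re_sum]
  have hterm : ∀ b, (star (M b *ᵥ v) ⬝ᵥ ∑ b', M b' *ᵥ v).re ≤
      C ^ 2 * eucNorm v ^ 2 + Fintype.card β * (2 * C ^ 2 * eucNorm v * eucNorm (v - lavg b v)) := by
    intro b
    rw [dotProduct_sum, Complex.re_sum, ← Finset.add_sum_erase _ _ (Finset.mem_univ b)]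
    refine add_le_add ?_ ?_
    · refine (Complex.re_le_norm _).trans ((norm_star_dotProduct_le _ _).trans ?_)
      have h := hM b v
      have h0 := eucNorm_nonneg (M b *ᵥ v)
      calc eucNorm (M b *ᵥ v) * eucNorm (M b *ᵥ v) ≤ (C * eucNorm v) * (C * eucNorm v) :=
            mul_le_mul h h h0 (mul_nonneg hC (eucNorm_nonneg v))
        _ = C ^ 2 * eucNorm v ^ 2 := by ring
    · calc ∑ b' ∈ Finset.univ.erase b, (star (M b *ᵥ v) ⬝ᵥ (M b' *ᵥ v)).re
          ≤ ∑ b' ∈ Finset.univ.erase b, 2 * C ^ 2 * eucNorm v * eucNorm (v - lavg b v) := by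
            refine Finset.sum_le_sum fun b' hb' => (Complex.re_le_norm _).trans ?_
            have hne : b ≠ b' := (Finset.ne_of_mem_erase hb').symm
            exact pair_cross_bound hC b (M b) (M b') (hM b) (hM b') (hcomm b b' hne) (hkill b) v
        _ = (Finset.univ.erase b).card * (2 * C ^ 2 * eucNorm v * eucNorm (v - lavg b v)) := by
            rw [Finset.sum_const, nsmul_eq_mul]
        _ ≤ Fintype.card β * (2 * C ^ 2 * eucNorm v * eucNorm (v - lavg b v)) := by
            refine mul_le_mul_of_nonneg_right ?_
              (mul_nonneg (mul_nonneg (mul_nonneg zero_le_two (sq_nonneg C)) (eucNorm_nonneg v))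
                (eucNorm_nonneg _))
            exact_mod_cast (Finset.card_erase_le).trans (Finset.card_univ (α := β)).le
  calc ∑ b, (star (M b *ᵥ v) ⬝ᵥ ∑ b', M b' *ᵥ v).re
      ≤ ∑ b : β, (C ^ 2 * eucNorm v ^ 2 +
          Fintype.card β * (2 * C ^ 2 * eucNorm v * eucNorm (v - lavg b v))) :=
        Finset.sum_le_sum fun b _ => hterm b
    _ = C ^ 2 * Fintype.card β * eucNorm v ^ 2 +
        2 * C ^ 2 * Fintype.card β * eucNorm v * ∑ b, eucNorm (v - lavg b v) := by
        rw [Finset.sum_add_distrib, Finset.sum_const, Finset.card_univ, nsmul_eq_mul, Finset.mul_sum]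
        congr 1
        · ring
        · exact Finset.sum_congr rfl fun b _ => by ring

end PairBound

/-! ### The model: named copies of the inlined objects of `ColourTheSpin.SgAnchorOrder` -/

section Model

open scoped Classical

/-- `Q8` multiplication (verbatim). [folklore] -/
def mQ : Q → Q → Q := fun u v => (u.1 + v.1, if u.1 = 0 then (if v.1 = 0 then u.2 + v.2 else v.2 - u.2) else if v.1 = 0 then u.2 + v.2 else 2 + v.2 - u.2)

/-- `Q8` inverse (verbatim). [folklore] -/
def ivQ : Q → Q := fun u => (u.1, if u.1 = 0 then -u.2 else u.2 + 2)

/-- The spin-½ representation (verbatim). [folklore] -/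
def rQ : Q → Fin 2 → Fin 2 → ℂ := fun u σ τ => if u.1 = 0 then (if σ = τ then (if σ = 0 then Complex.I else -Complex.I) ^ u.2.val else 0) else if σ = τ then 0 else if σ = 0 then -(-Complex.I) ^ u.2.val else Complex.I ^ u.2.val

variable (L : ℕ) [NeZero L]

/-- Link configurations. [folklore] -/
abbrev K : Type := GaugedHubbard.Bond L → Q
/-- Fermion occupation configurations. [folklore] -/
abbrev F : Type := Finset (Orb (FermionTorus 2 L))

/-- The gauged hopping (verbatim). [folklore] -/
def hopQ : Matrix (F L × K L) (F L × K L) ℂ :=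
  ∑ b : GaugedHubbard.Bond L, ∑ σ : Fin 2, ∑ τ : Fin 2, Matrix.kroneckerMap (· * ·) (creation (orb b.1 σ) * annihilation (orb (b.1.shift b.2) τ)) (Matrix.diagonal fun k : GaugedHubbard.Bond L → Fin 2 × ZMod 4 => rQ (k b) σ τ)

/-- The magnetic weight of a link configuration (verbatim). [folklore] -/
def magW (k : K L) : ℂ :=
  ∑ x : FermionTorus 2 L, (1 - (rQ (mQ (mQ (mQ (k (x, 0)) (k (x.shift 0, 1))) (ivQ (k (x.shift 1, 0)))) (ivQ (k (x, 1)))) 0 0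
                + rQ (mQ (mQ (mQ (k (x, 0)) (k (x.shift 0, 1))) (ivQ (k (x.shift 1, 0)))) (ivQ (k (x, 1)))) 1 1) / 2)

/-- The doublon count (verbatim). [folklore] -/
def dblQ : Matrix (F L) (F L) ℂ := ∑ x : FermionTorus 2 L, numberOp x 0 * numberOp x 1

/-- The gauged Hamiltonian `H_g(L,U)` (verbatim). [folklore] -/
def HQ (U g : ℝ) : Matrix (F L × K L) (F L × K L) ℂ :=
  -(hopQ L + (hopQ L)ᴴ)
    + ((U : ℝ) : ℂ) • Matrix.kroneckerMap (· * ·) (dblQ L) (1 : Matrix (GaugedHubbard.Bond L → Fin 2 × ZMod 4) (GaugedHubbard.Bond L → Fin 2 × ZMod 4) ℂ)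
    + ((g ^ 2 : ℝ) : ℂ) • Matrix.kroneckerMap (· * ·) (1 : Matrix (Finset (Orb (FermionTorus 2 L))) _ ℂ) (elOp (GaugedHubbard.Bond L))
    + ((1 / g ^ 2 : ℝ) : ℂ) • Matrix.kroneckerMap (· * ·) (1 : Matrix (Finset (Orb (FermionTorus 2 L))) _ ℂ) (Matrix.diagonal (magW L))

/-- The link weight of the pair field on bond `b` (verbatim). [folklore] -/
def pairD (b : GaugedHubbard.Bond L) (σ τ : Fin 2) : K L → ℂ :=
  fun k => if σ = 0 then rQ (k b) 1 τ else -rQ (k b) 0 τ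

/-- The bond-`b` piece of the pair field (verbatim). [folklore] -/
def Pb (b : GaugedHubbard.Bond L) : Matrix (F L × K L) (F L × K L) ℂ :=
  (if b.2 = 0 then (1 : ℂ) else -1) • ∑ σ : Fin 2, ∑ τ : Fin 2, Matrix.kroneckerMap (· * ·) (annihilation (orb b.1 σ) * annihilation (orb (b.1.shift b.2) τ))
            (Matrix.diagonal (pairD L b σ τ))

/-- The gauge-invariant `B1g` pair field (verbatim). [folklore] -/
def PQ : Matrix (F L × K L) (F L × K L) ℂ := ∑ b : GaugedHubbard.Bond L, Pb L b

/-- The particle-number constraint (verbatim). [folklore] -/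
abbrev pN (δ : ℝ) : F L × K L → Prop := fun ik => ik.1.card = 2 * ⌊(1 - δ) * (L : ℝ) ^ 2 / 2⌋₊

/-- Every-ground-state pair order of the block at `(U, δ, g, c, L)`. [folklore] -/
def BlockOrder (U δ g c : ℝ) : Prop :=
  ∀ ψ : {ik // pN L δ ik} → ℂ,
    (ψ ≠ 0 ∧ ∃ E : ℝ, (HQ L U g).toBlock (pN L δ) (pN L δ) *ᵥ ψ = (E : ℂ) • ψ ∧
      ∀ φ : {ik // pN L δ ik} → ℂ, E * (star φ ⬝ᵥ φ).re ≤ (star φ ⬝ᵥ (HQ L U g).toBlock (pN L δ) (pN L δ) *ᵥ φ).re) →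
    c * (L : ℝ) ^ 4 * (star ψ ⬝ᵥ ψ).re ≤ (star ψ ⬝ᵥ ((PQ L)ᴴ * PQ L).toBlock (pN L δ) (pN L δ) *ᵥ ψ).re

set_option maxHeartbeats 2000000 in
/-- The route item, prefix-normalised: `SgAnchorOrder` says the block order holds with one constant
on a whole half-line of gauge couplings. [folklore] -/
theorem sgAnchorOrder_iff :
    Theses.ColourTheSpin.SgAnchorOrder ↔
      ∃ U : ℝ, 0 < U ∧ ∃ δ ∈ Set.Ioo (0 : ℝ) (1 / 2), ∃ g₀ : ℝ, 0 < g₀ ∧ ∃ c : ℝ, 0 < c ∧ ∃ L₀ : ℕ,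
        ∀ g : ℝ, g₀ ≤ g → ∀ (L : ℕ) [NeZero L], L₀ ≤ L → Even L → BlockOrder L U δ g c :=
  Iff.rfl

/-- The link-constant trial state on the occupation configuration `s₀`. [folklore] -/
def trialV (s₀ : F L) : F L × K L → ℂ := fun ik => if ik.1 = s₀ then 1 else 0

end Model

/-! ### The representation: bounds and sums -/

section Rep

/-- `|ρ(u)_{στ}| ≤ 1` (entries are `0` or powers of `±i`). [folklore] -/
theorem norm_rQ_le (u : Q) (σ τ : Fin 2) : ‖rQ u σ τ‖ ≤ 1 := by
  unfold rQ
  split_ifs <;> simp [norm_pow, Complex.norm_I]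

/-- `|Re ρ(u)_{στ}| ≤ 1`. [folklore] -/
theorem re_rQ_le (u : Q) (σ τ : Fin 2) : |(rQ u σ τ).re| ≤ 1 :=
  (Complex.abs_re_le_norm _).trans (norm_rQ_le u σ τ)

/-- `ρ(u)₀₀ = i^n` on the abelian part, `0` otherwise. [folklore] -/
theorem rQ_zero_zero (u : Q) : rQ u 0 0 = if u.1 = 0 then Complex.I ^ u.2.val else 0 := by
  unfold rQ
  split_ifs <;> simp_all

/-- `ρ(u)₁₁ = (-i)^n` on the abelian part, `0` otherwise. [folklore] -/
theorem rQ_one_one (u : Q) : rQ u 1 1 = if u.1 = 0 then (-Complex.I) ^ u.2.val else 0 := by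
  unfold rQ
  split_ifs <;> simp_all

/-- `tr ρ(u)` is real. [folklore] -/
theorem star_rQ_diag (u : Q) : star (rQ u 0 0 + rQ u 1 1) = rQ u 0 0 + rQ u 1 1 := by
  rw [rQ_zero_zero, rQ_one_one]
  split_ifs
  · rw [star_add, star_pow, star_pow, star_neg, Complex.star_def, Complex.conj_I, neg_neg, add_comm]
  · simp

/-- `Σ_{n ∈ ℤ/4} iⁿ = 0`. [folklore] -/
theorem sum_I_pow_val : ∑ n : ZMod 4, Complex.I ^ n.val = 0 := by
  show ∑ i : Fin 4, Complex.I ^ (i.val) = 0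
  rw [Fin.sum_univ_eq_sum_range (fun m => Complex.I ^ m) 4]
  simp only [Finset.sum_range_succ, Finset.sum_range_zero, pow_zero, pow_one, zero_add]
  have h2 : Complex.I ^ 2 = -1 := Complex.I_sq
  have h3 : Complex.I ^ 3 = -Complex.I := by rw [pow_succ, h2]; ring
  rw [h2, h3]; ring

/-- `Σ_{n ∈ ℤ/4} (-i)ⁿ = 0`. [folklore] -/
theorem sum_negI_pow_val : ∑ n : ZMod 4, (-Complex.I) ^ n.val = 0 := by
  show ∑ i : Fin 4, (-Complex.I) ^ (i.val) = 0
  rw [Fin.sum_univ_eq_sum_range (fun m => (-Complex.I) ^ m) 4]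
  simp only [Finset.sum_range_succ, Finset.sum_range_zero, pow_zero, pow_one, zero_add]
  have h2 : (-Complex.I) ^ 2 = -1 := by rw [neg_sq]; exact Complex.I_sq
  have h3 : (-Complex.I) ^ 3 = Complex.I := by rw [pow_succ, h2]; ring
  rw [h2, h3]; ring

/-- **Schur/Elitzur average:** `Σ_{u ∈ Q8} ρ(u)_{στ} = 0` — a single hop or a bond pair always excites the link out of the flux-free function. [folklore] -/
theorem sum_rQ (σ τ : Fin 2) : ∑ u : Q, rQ u σ τ = 0 := by
  rw [Fintype.sum_prod_type, Fin.sum_univ_two]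
  fin_cases σ <;> fin_cases τ <;>
    simp [rQ, sum_I_pow_val, sum_negI_pow_val, Finset.sum_neg_distrib]

end Rep

/-! ### Blocks: extension by zero -/

section Block

variable {n : Type*} (p : n → Prop) [DecidablePred p]

/-- Extension by zero of a block vector. [folklore] -/
def ext0 (ψ : {i // p i} → ℂ) : n → ℂ := fun i => if h : p i then ψ ⟨i, h⟩ else 0

/-- Extension by zero is injective on nonzero vectors. [folklore] -/
theorem ext0_ne_zero {ψ : {i // p i} → ℂ} (h : ψ ≠ 0) : ext0 p ψ ≠ 0 := by
  intro h0
  apply h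
  funext a
  have := congrFun h0 a
  simpa [ext0, a.2] using this

/-- Restricting a vector supported in the block and extending by zero gives it back. [folklore] -/
theorem ext0_restrict (τ : n → ℂ) (hτ : ∀ i, ¬ p i → τ i = 0) :
    ext0 p (fun a => τ a) = τ := by
  funext i
  by_cases hi : p i
  · simp [ext0, hi]
  · simp [ext0, hi, hτ i hi]

variable [Fintype n]

/-- A sum over the block equals the sum of the zero-extended summand. [folklore] -/
theorem sum_ext (Fv : {i // p i} → ℂ) :
    ∑ i, (if h : p i then Fv ⟨i, h⟩ else 0) = ∑ a, Fv a := by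
  have h1 : ∑ i, (if h : p i then Fv ⟨i, h⟩ else 0) =
      ∑ i ∈ Finset.univ.filter p, (if h : p i then Fv ⟨i, h⟩ else 0) := by
    rw [Finset.sum_filter]
    refine Finset.sum_congr rfl fun i _ => ?_
    by_cases hi : p i <;> simp [hi]
  have h2 := Finset.sum_subtype (p := p) (F := inferInstance) (Finset.univ.filter p) (fun x => by simp)
    (fun i => if h : p i then Fv ⟨i, h⟩ else 0)
  rw [h1, h2]
  refine Fintype.sum_congr _ _ fun a => ?_
  simp [a.2]

/-- `(M|_block ψ)(a) = (M ψ̃)(a)` for the extension by zero `ψ̃`. [folklore] -/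
theorem toBlock_mulVec_apply (M : Matrix n n ℂ) (ψ : {i // p i} → ℂ) (a : {i // p i}) :
    (M.toBlock p p *ᵥ ψ) a = (M *ᵥ ext0 p ψ) a := by
  simp only [mulVec, dotProduct, toBlock_apply, ext0]
  rw [← sum_ext p (fun b => M a b * ψ b)]
  refine Finset.sum_congr rfl fun i _ => ?_
  by_cases hi : p i <;> simp [hi]

/-- `⟨ψ, M|_block ψ⟩ = ⟨ψ̃, M ψ̃⟩`. [folklore] -/
theorem star_dotProduct_toBlock_mulVec (M : Matrix n n ℂ) (ψ : {i // p i} → ℂ) :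
    star ψ ⬝ᵥ (M.toBlock p p *ᵥ ψ) = star (ext0 p ψ) ⬝ᵥ (M *ᵥ ext0 p ψ) := by
  simp only [dotProduct, Pi.star_apply, toBlock_mulVec_apply]
  rw [← sum_ext p (fun a => star (ψ a) * (M *ᵥ ext0 p ψ) a)]
  refine Finset.sum_congr rfl fun i _ => ?_
  by_cases hi : p i <;> simp [hi, ext0]

/-- `⟨ψ, ψ⟩ = ⟨ψ̃, ψ̃⟩`. [folklore] -/
theorem star_dotProduct_block (ψ : {i // p i} → ℂ) :
    star ψ ⬝ᵥ ψ = star (ext0 p ψ) ⬝ᵥ ext0 p ψ := by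
  simp only [dotProduct, Pi.star_apply]
  rw [← sum_ext p (fun a => star (ψ a) * ψ a)]
  refine Finset.sum_congr rfl fun i _ => ?_
  by_cases hi : p i <;> simp [hi, ext0]

/-- A Hermitian matrix on a nonempty index type has a ground state in the Rayleigh sense. [folklore] -/
theorem exists_ground {m : Type*} [Fintype m] [DecidableEq m] [Nonempty m] {A : Matrix m m ℂ}
    (hA : A.IsHermitian) :
    ∃ ψ : m → ℂ, ψ ≠ 0 ∧ ∃ E : ℝ, A *ᵥ ψ = (E : ℂ) • ψ ∧
      ∀ φ : m → ℂ, E * (star φ ⬝ᵥ φ).re ≤ (star φ ⬝ᵥ A *ᵥ φ).re := by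
  obtain ⟨ψ, hψ, hψ0⟩ := (Submodule.ne_bot_iff _).1 (groundSpace_ne_bot_holds hA)
  refine ⟨ψ, hψ0, A.groundEnergy, (mem_groundSpace_iff A ψ).1 hψ, fun φ => ?_⟩
  have h := (posSemidef_sub_groundEnergy hA).dotProduct_mulVec_nonneg φ
  rw [sub_mulVec, dotProduct_sub, Algebra.algebraMap_eq_smul_one, smul_mulVec, one_mulVec,
    dotProduct_smul] at h
  obtain ⟨hre, -⟩ := Complex.nonneg_iff.mp h
  simp only [Complex.sub_re, Complex.real_smul, Complex.mul_re, Complex.ofReal_re,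
    Complex.ofReal_im, zero_mul, sub_zero] at hre
  linarith

end Block

end SgAnchorFreeze

end Summit.HubbardSuperconductivity.HubbardSuperconductivity.Theorems
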